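import Mathlib.LinearAlgebra.Matrix.Trace
import Mathlib.LinearAlgebra.Matrix.ConjTranspose
import Mathlib.LinearAlgebra.UnitaryGroup
import Mathlib.Analysis.Complex.Basic
import HarnessLib

/-!
# Venture YMGap — Theorem C (sharp Hessian constant `4d` of the Wilson action), kernel part 1:
# the single-plaquette lemma as a four-square sum of squares

HONEST FRAMING: venture file (cell `pub-ymgap`, track (a), item A2 = "Theorem C" of
`p2/HESSIAN-SHARP.md`, referee-checked inside the cell). This file kernel-checks the single-plaquette
lemma (SPL, HESSIAN-SHARP §2 Lemma 2) in the basis-free form of `p2/SPL-SOS.md`; it makes no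
statement about measures, Bakry–Émery constants or thresholds. The identification of `word2` with
an actual second derivative of `t ↦ Re tr(e^{tV₁}B₁e^{tV₂}B₂e^{tV₃}B₃e^{tV₄}B₄)` (it is, by the
product rule, twice its `t²`-Taylor coefficient) is NOT proved here; `word2` is DEFINED as that
explicit polynomial.

## Contents
* `frobSq A = Re tr(A Aᴴ) = Σ |A_ij|²` and its algebra (`frobSq_add`, invariance under unitaries).
* `re_trace_mul_mul_le`: `Re tr(X Z W) ≤ (‖X‖² + ‖Z‖²)/2` whenever `W Wᴴ = 1` — the square
  `0 ≤ ‖Xᴴ − Z W‖²`.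
* `word2 V₁ B₁ V₂ B₂ V₃ B₃ V₄ B₄` : twice the second-order Taylor coefficient of the cyclic word,
  `Re tr[Σ_i (V_i² in slot i) + 2 Σ_{i<j} (V_i in slot i)(V_j in slot j)]`.
* `word2_eq_cornerTraces` (the identity (S1) of SPL-SOS): with `α_k := V_k + B_k V_{k+1} B_kᴴ`
  (indices mod 4), `word2 = Σ_k Re tr(α_k B_k α_{k+1} B_{k+1} B_{k+2} B_{k+3})` — only
  `B_kᴴ B_k = 1` and cyclicity of the trace are used.
* `word2_le_cornerSq` (SPL): for unitary `B_k` and ARBITRARY `V_k`,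
  `word2 ≤ Σ_k ‖V_k + B_k V_{k+1} B_kᴴ‖²`; for a lattice plaquette these four squares are the four
  corner terms `‖X̂_e(v) − X̂_{e'}(v)‖²` (see `HessianSharp.lean`).

Reference: cell files `run/shared/lean/pub/pub-ymgap/p2/SPL-SOS.md` §1–§2, `p2/HESSIAN-SHARP.md` §2;
background H. Shen, R. Zhu, X. Zhu, CMP 400 (2023) 805, Lemma 4.1 (whose per-plaquette
Cauchy–Schwarz count `8(d-1)` the venture sharpens to `4d`).
-/

noncomputable section

namespace Summit.Ventures.YMGap.HessianSharp

open Matrix Complex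
open scoped Matrix ComplexConjugate BigOperators

variable {n : Type*} [Fintype n]

/-! ## The squared Frobenius norm as a trace -/

/-- The squared Frobenius (Hilbert–Schmidt) norm of a complex square matrix, written as
`Re tr(A Aᴴ)` (it equals `Σ_{ij} |A_{ij}|²`, `frobSq_eq_sum`). -/
def frobSq (A : Matrix n n ℂ) : ℝ := (A * Aᴴ).trace.re

/-- `Re tr(A Aᴴ) = Σ_{ij} |A_{ij}|²`. -/
theorem frobSq_eq_sum (A : Matrix n n ℂ) : frobSq A = ∑ i, ∑ j, Complex.normSq (A i j) := by
  unfold frobSq Matrix.trace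
  rw [Complex.re_sum]
  refine Finset.sum_congr rfl fun i _ => ?_
  rw [Matrix.diag_apply, Matrix.mul_apply, Complex.re_sum]
  refine Finset.sum_congr rfl fun j _ => ?_
  rw [Matrix.conjTranspose_apply, Complex.star_def, Complex.mul_conj, Complex.ofReal_re]

/-- `‖A‖² ≥ 0`. -/
theorem frobSq_nonneg (A : Matrix n n ℂ) : 0 ≤ frobSq A := by
  rw [frobSq_eq_sum]
  exact Finset.sum_nonneg fun i _ => Finset.sum_nonneg fun j _ => Complex.normSq_nonneg _

/-- `Re tr(Aᴴ) = Re tr(A)`. -/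
theorem re_trace_conjTranspose (A : Matrix n n ℂ) : (Aᴴ).trace.re = A.trace.re := by
  rw [Matrix.trace_conjTranspose, Complex.star_def, Complex.conj_re]

/-- `‖Aᴴ‖² = ‖A‖²`. -/
theorem frobSq_conjTranspose (A : Matrix n n ℂ) : frobSq Aᴴ = frobSq A := by
  unfold frobSq
  rw [conjTranspose_conjTranspose, Matrix.trace_mul_comm]

/-- `‖-A‖² = ‖A‖²`. -/
theorem frobSq_neg (A : Matrix n n ℂ) : frobSq (-A) = frobSq A := by
  unfold frobSq
  rw [conjTranspose_neg, Matrix.neg_mul, Matrix.mul_neg, neg_neg]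

/-- Polarisation: `‖A + B‖² = ‖A‖² + ‖B‖² + 2 Re tr(A Bᴴ)`. -/
theorem frobSq_add (A B : Matrix n n ℂ) :
    frobSq (A + B) = frobSq A + frobSq B + 2 * (A * Bᴴ).trace.re := by
  unfold frobSq
  have h : (B * Aᴴ).trace.re = (A * Bᴴ).trace.re := by
    rw [← re_trace_conjTranspose (B * Aᴴ), conjTranspose_mul, conjTranspose_conjTranspose]
  rw [conjTranspose_add, Matrix.add_mul, Matrix.mul_add, Matrix.mul_add, trace_add, trace_add,
    trace_add, Complex.add_re, Complex.add_re, Complex.add_re, h]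
  ring

/-- `‖A - B‖² = ‖A‖² + ‖B‖² - 2 Re tr(A Bᴴ)`. -/
theorem frobSq_sub (A B : Matrix n n ℂ) :
    frobSq (A - B) = frobSq A + frobSq B - 2 * (A * Bᴴ).trace.re := by
  rw [sub_eq_add_neg, frobSq_add, frobSq_neg, conjTranspose_neg, Matrix.mul_neg, trace_neg,
    Complex.neg_re]
  ring

section Unitary

variable [DecidableEq n]

/-- Right multiplication by a co-isometry preserves the norm: `W Wᴴ = 1 ⇒ ‖A W‖² = ‖A‖²`. -/
theorem frobSq_mul_of_mul_conjTranspose (A W : Matrix n n ℂ) (hW : W * Wᴴ = 1) :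
    frobSq (A * W) = frobSq A := by
  unfold frobSq
  rw [conjTranspose_mul, Matrix.mul_assoc, ← Matrix.mul_assoc W, hW, Matrix.one_mul]

/-- Left multiplication by an isometry preserves the norm: `Wᴴ W = 1 ⇒ ‖W A‖² = ‖A‖²`. -/
theorem frobSq_mul_of_conjTranspose_mul (W A : Matrix n n ℂ) (hW : Wᴴ * W = 1) :
    frobSq (W * A) = frobSq A := by
  unfold frobSq
  rw [conjTranspose_mul, show W * A * (Aᴴ * Wᴴ) = W * (A * Aᴴ * Wᴴ) by simp only [Matrix.mul_assoc],
    Matrix.trace_mul_comm, Matrix.mul_assoc, hW, Matrix.mul_one]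

/-- Conjugation invariance: `‖W A Wᴴ‖² = ‖A‖²` for `Wᴴ W = 1`. -/
theorem frobSq_conj (W A : Matrix n n ℂ) (hW : Wᴴ * W = 1) :
    frobSq (W * A * Wᴴ) = frobSq A := by
  have hW' : Wᴴ * Wᴴᴴ = 1 := by rw [conjTranspose_conjTranspose, hW]
  rw [frobSq_mul_of_mul_conjTranspose _ _ hW', frobSq_mul_of_conjTranspose_mul _ _ hW]

/-- Conjugation invariance, other side: `‖Wᴴ A W‖² = ‖A‖²` for `W Wᴴ = 1`. -/
theorem frobSq_conj' (W A : Matrix n n ℂ) (hW : W * Wᴴ = 1) :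
    frobSq (Wᴴ * A * W) = frobSq A := by
  have h := frobSq_conj Wᴴ A (by rw [conjTranspose_conjTranspose, hW])
  rwa [conjTranspose_conjTranspose] at h

/-! ## The one inequality: `Re tr(X Z W) ≤ (‖X‖² + ‖Z‖²)/2` for `W Wᴴ = 1` -/

/-- **The square behind the single-plaquette lemma.** For any `X, Z` and any `W` with
`W Wᴴ = 1`: `Re tr(X Z W) ≤ (‖X‖² + ‖Z‖²)/2`, because `0 ≤ ‖Xᴴ − Z W‖² = ‖X‖² + ‖Z‖² − 2 Re tr(X Z W)`
(SPL-SOS §2). -/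
theorem re_trace_mul_mul_le (X Z W : Matrix n n ℂ) (hW : W * Wᴴ = 1) :
    (X * Z * W).trace.re ≤ (frobSq X + frobSq Z) / 2 := by
  have h0 : 0 ≤ frobSq (Xᴴ - Z * W) := frobSq_nonneg _
  have h1 : (Xᴴ * (Z * W)ᴴ).trace.re = (X * Z * W).trace.re := by
    rw [← conjTranspose_mul, re_trace_conjTranspose, Matrix.trace_mul_cycle]
  rw [frobSq_sub, frobSq_conjTranspose, frobSq_mul_of_mul_conjTranspose _ _ hW, h1] at h0
  linarith

end Unitary

/-! ## The second-order word and the single-plaquette lemma -/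

/-- **Twice the `t²`-Taylor coefficient of the cyclic word.** For the one-parameter family
`t ↦ tr(e^{tV₁} B₁ e^{tV₂} B₂ e^{tV₃} B₃ e^{tV₄} B₄)` the product rule gives the second derivative at
`t = 0` as `tr[Σ_i (word with V_i² inserted in slot i) + 2 Σ_{i<j} (word with V_i, V_j inserted in
slots i, j)]`; `word2` is the real part of exactly this polynomial (the calculus identification is not
part of this file). For a lattice plaquette `(x; i<j)` with links `Q₁..Q₄` perturbed as `e^{tX_e}Q_e`
one takes `V = (X₁, X₂, -X₃, -X₄)`, `B = (Q₁, Q₂Q₃ᴴ, Q₄ᴴ, 1)` (`HessianSharp.lean`, `plaqHess`);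
in Shen–Zhu–Zhu's transported variables it is `Σ_i Re tr(Ỹ_i² W) + 2Σ_{i<j} Re tr(Ỹ_iỸ_jW)`
(HESSIAN-SHARP (0.1)). -/
def word2 (V₁ B₁ V₂ B₂ V₃ B₃ V₄ B₄ : Matrix n n ℂ) : ℝ :=
  ((V₁ * V₁ * B₁ * B₂ * B₃ * B₄).trace + (B₁ * V₂ * V₂ * B₂ * B₃ * B₄).trace
    + (B₁ * B₂ * V₃ * V₃ * B₃ * B₄).trace + (B₁ * B₂ * B₃ * V₄ * V₄ * B₄).trace
    + 2 * ((V₁ * B₁ * V₂ * B₂ * B₃ * B₄).trace + (V₁ * B₁ * B₂ * V₃ * B₃ * B₄).trace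
      + (V₁ * B₁ * B₂ * B₃ * V₄ * B₄).trace + (B₁ * V₂ * B₂ * V₃ * B₃ * B₄).trace
      + (B₁ * V₂ * B₂ * B₃ * V₄ * B₄).trace + (B₁ * B₂ * V₃ * B₃ * V₄ * B₄).trace)).re

/-- Cyclic rotation of a six-fold product under the trace (right-associated form):
`tr(M₁M₂M₃M₄M₅V) = tr(V M₁M₂M₃M₄M₅)`. -/
theorem trace_rot6 (M₁ M₂ M₃ M₄ M₅ V : Matrix n n ℂ) :
    (M₁ * (M₂ * (M₃ * (M₄ * (M₅ * V))))).trace = (V * (M₁ * (M₂ * (M₃ * (M₄ * M₅))))).trace := by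
  have h : M₁ * (M₂ * (M₃ * (M₄ * (M₅ * V)))) = M₁ * (M₂ * (M₃ * (M₄ * M₅))) * V := by
    simp only [Matrix.mul_assoc]
  rw [h, Matrix.trace_mul_comm]

section SPL

variable [DecidableEq n]

/-- **Identity (S1) of SPL-SOS** (the algebraic heart). With `α₁ = V₁ + B₁V₂B₁ᴴ`,
`α₂ = V₂ + B₂V₃B₂ᴴ`, `α₃ = V₃ + B₃V₄B₃ᴴ`, `α₄ = V₄ + B₄V₁B₄ᴴ` and isometries `B_kᴴB_k = 1`:
`word2 = Re tr(α₁B₁α₂B₂B₃B₄) + Re tr(B₁α₂B₂α₃B₃B₄) + Re tr(B₁B₂α₃B₃α₄B₄) + Re tr(α₁B₁B₂B₃α₄B₄)`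
— the four CYCLICALLY ADJACENT slot pairs. Proof: expand (16 monomials), cancel `B_kᴴB_k`, rotate the
four monomials that end in `V₁`, compare coefficients. -/
theorem word2_eq_cornerTraces (V₁ B₁ V₂ B₂ V₃ B₃ V₄ B₄ : Matrix n n ℂ)
    (hB₁ : B₁ᴴ * B₁ = 1) (hB₂ : B₂ᴴ * B₂ = 1) (hB₃ : B₃ᴴ * B₃ = 1) (hB₄ : B₄ᴴ * B₄ = 1) :
    word2 V₁ B₁ V₂ B₂ V₃ B₃ V₄ B₄ =
      ((V₁ + B₁ * V₂ * B₁ᴴ) * B₁ * (V₂ + B₂ * V₃ * B₂ᴴ) * B₂ * B₃ * B₄).trace.re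
      + (B₁ * (V₂ + B₂ * V₃ * B₂ᴴ) * B₂ * (V₃ + B₃ * V₄ * B₃ᴴ) * B₃ * B₄).trace.re
      + (B₁ * B₂ * (V₃ + B₃ * V₄ * B₃ᴴ) * B₃ * (V₄ + B₄ * V₁ * B₄ᴴ) * B₄).trace.re
      + ((V₁ + B₁ * V₂ * B₁ᴴ) * B₁ * B₂ * B₃ * (V₄ + B₄ * V₁ * B₄ᴴ) * B₄).trace.re := by
  have c₁ : ∀ M : Matrix n n ℂ, B₁ᴴ * (B₁ * M) = M := fun M => by
    rw [← Matrix.mul_assoc, hB₁, Matrix.one_mul]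
  have c₂ : ∀ M : Matrix n n ℂ, B₂ᴴ * (B₂ * M) = M := fun M => by
    rw [← Matrix.mul_assoc, hB₂, Matrix.one_mul]
  have c₃ : ∀ M : Matrix n n ℂ, B₃ᴴ * (B₃ * M) = M := fun M => by
    rw [← Matrix.mul_assoc, hB₃, Matrix.one_mul]
  have key :
      ((V₁ + B₁ * V₂ * B₁ᴴ) * B₁ * (V₂ + B₂ * V₃ * B₂ᴴ) * B₂ * B₃ * B₄).trace
      + (B₁ * (V₂ + B₂ * V₃ * B₂ᴴ) * B₂ * (V₃ + B₃ * V₄ * B₃ᴴ) * B₃ * B₄).trace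
      + (B₁ * B₂ * (V₃ + B₃ * V₄ * B₃ᴴ) * B₃ * (V₄ + B₄ * V₁ * B₄ᴴ) * B₄).trace
      + ((V₁ + B₁ * V₂ * B₁ᴴ) * B₁ * B₂ * B₃ * (V₄ + B₄ * V₁ * B₄ᴴ) * B₄).trace
      = (V₁ * V₁ * B₁ * B₂ * B₃ * B₄).trace + (B₁ * V₂ * V₂ * B₂ * B₃ * B₄).trace
        + (B₁ * B₂ * V₃ * V₃ * B₃ * B₄).trace + (B₁ * B₂ * B₃ * V₄ * V₄ * B₄).trace
        + 2 * ((V₁ * B₁ * V₂ * B₂ * B₃ * B₄).trace + (V₁ * B₁ * B₂ * V₃ * B₃ * B₄).trace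
          + (V₁ * B₁ * B₂ * B₃ * V₄ * B₄).trace + (B₁ * V₂ * B₂ * V₃ * B₃ * B₄).trace
          + (B₁ * V₂ * B₂ * B₃ * V₄ * B₄).trace + (B₁ * B₂ * V₃ * B₃ * V₄ * B₄).trace) := by
    simp only [Matrix.mul_assoc, Matrix.add_mul, Matrix.mul_add, Matrix.trace_add, c₁, c₂, c₃, hB₄,
      Matrix.mul_one]
    rw [trace_rot6 B₁ B₂ V₃ B₃ B₄ V₁, trace_rot6 B₁ B₂ B₃ V₄ B₄ V₁, trace_rot6 V₁ B₁ B₂ B₃ B₄ V₁,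
      trace_rot6 B₁ V₂ B₂ B₃ B₄ V₁]
    ring
  unfold word2
  rw [← key, Complex.add_re, Complex.add_re, Complex.add_re]

/-- A member of the unitary group satisfies `Bᴴ B = 1`. -/
theorem conjTranspose_mul_self_of_mem {B : Matrix n n ℂ} (hB : B ∈ Matrix.unitaryGroup n ℂ) :
    Bᴴ * B = 1 := by
  have h := Matrix.mem_unitaryGroup_iff'.mp hB
  rwa [Matrix.star_eq_conjTranspose] at h

/-- A member of the unitary group satisfies `B Bᴴ = 1`. -/
theorem mul_conjTranspose_self_of_mem {B : Matrix n n ℂ} (hB : B ∈ Matrix.unitaryGroup n ℂ) :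
    B * Bᴴ = 1 := by
  have h := Matrix.mem_unitaryGroup_iff.mp hB
  rwa [Matrix.star_eq_conjTranspose] at h

/-- **The single-plaquette lemma (SPL), four-square form** (SPL-SOS (S2); HESSIAN-SHARP Lemma 2).
For unitary `B₁..B₄` and ARBITRARY complex matrices `V₁..V₄`:
`word2 V B ≤ ‖V₁ + B₁V₂B₁ᴴ‖² + ‖V₂ + B₂V₃B₂ᴴ‖² + ‖V₃ + B₃V₄B₃ᴴ‖² + ‖V₄ + B₄V₁B₄ᴴ‖²`.
Proof: identity (S1) and `re_trace_mul_mul_le` once per cyclically adjacent pair; each `α_k` occurs in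
exactly two pairs, whence the constant `1`. -/
theorem word2_le_cornerSq (V₁ B₁ V₂ B₂ V₃ B₃ V₄ B₄ : Matrix n n ℂ)
    (hB₁ : B₁ ∈ Matrix.unitaryGroup n ℂ) (hB₂ : B₂ ∈ Matrix.unitaryGroup n ℂ)
    (hB₃ : B₃ ∈ Matrix.unitaryGroup n ℂ) (hB₄ : B₄ ∈ Matrix.unitaryGroup n ℂ) :
    word2 V₁ B₁ V₂ B₂ V₃ B₃ V₄ B₄ ≤
      frobSq (V₁ + B₁ * V₂ * B₁ᴴ) + frobSq (V₂ + B₂ * V₃ * B₂ᴴ)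
        + frobSq (V₃ + B₃ * V₄ * B₃ᴴ) + frobSq (V₄ + B₄ * V₁ * B₄ᴴ) := by
  have u₁ := conjTranspose_mul_self_of_mem hB₁
  have u₂ := conjTranspose_mul_self_of_mem hB₂
  have u₃ := conjTranspose_mul_self_of_mem hB₃
  have u₄ := conjTranspose_mul_self_of_mem hB₄
  have w₁ := mul_conjTranspose_self_of_mem hB₁
  have w₂ := mul_conjTranspose_self_of_mem hB₂
  have w₃ := mul_conjTranspose_self_of_mem hB₃
  have w₄ := mul_conjTranspose_self_of_mem hB₄
  rw [word2_eq_cornerTraces V₁ B₁ V₂ B₂ V₃ B₃ V₄ B₄ u₁ u₂ u₃ u₄]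
  set α₁ := V₁ + B₁ * V₂ * B₁ᴴ with hα₁
  set α₂ := V₂ + B₂ * V₃ * B₂ᴴ with hα₂
  set α₃ := V₃ + B₃ * V₄ * B₃ᴴ with hα₃
  set α₄ := V₄ + B₄ * V₁ * B₄ᴴ with hα₄
  -- the co-isometries closing each word
  have h234 : B₂ * B₃ * B₄ * (B₂ * B₃ * B₄)ᴴ = 1 := by
    rw [conjTranspose_mul, conjTranspose_mul, Matrix.mul_assoc, Matrix.mul_assoc,
      ← Matrix.mul_assoc B₄, w₄, Matrix.one_mul, ← Matrix.mul_assoc B₃, w₃, Matrix.one_mul, w₂]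
  have h34 : B₃ * B₄ * (B₃ * B₄)ᴴ = 1 := by
    rw [conjTranspose_mul, Matrix.mul_assoc, ← Matrix.mul_assoc B₄, w₄, Matrix.one_mul, w₃]
  -- pair (1,2)
  have b₁ : (α₁ * B₁ * α₂ * B₂ * B₃ * B₄).trace.re ≤ (frobSq α₁ + frobSq α₂) / 2 := by
    have h := re_trace_mul_mul_le (α₁ * B₁) α₂ (B₂ * B₃ * B₄) h234
    rw [frobSq_mul_of_mul_conjTranspose _ _ w₁] at h
    have e : α₁ * B₁ * α₂ * (B₂ * B₃ * B₄) = α₁ * B₁ * α₂ * B₂ * B₃ * B₄ := by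
      simp only [Matrix.mul_assoc]
    rwa [e] at h
  -- pair (2,3)
  have b₂ : (B₁ * α₂ * B₂ * α₃ * B₃ * B₄).trace.re ≤ (frobSq α₂ + frobSq α₃) / 2 := by
    have h := re_trace_mul_mul_le (B₁ * α₂ * B₂) α₃ (B₃ * B₄) h34
    rw [frobSq_mul_of_mul_conjTranspose _ _ w₂, frobSq_mul_of_conjTranspose_mul _ _ u₁] at h
    have e : B₁ * α₂ * B₂ * α₃ * (B₃ * B₄) = B₁ * α₂ * B₂ * α₃ * B₃ * B₄ := by
      simp only [Matrix.mul_assoc]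
    rwa [e] at h
  -- pair (3,4)
  have b₃ : (B₁ * B₂ * α₃ * B₃ * α₄ * B₄).trace.re ≤ (frobSq α₃ + frobSq α₄) / 2 := by
    have h := re_trace_mul_mul_le (B₁ * B₂ * α₃ * B₃) α₄ B₄ w₄
    have hu : (B₁ * B₂)ᴴ * (B₁ * B₂) = 1 := by
      rw [conjTranspose_mul, Matrix.mul_assoc, ← Matrix.mul_assoc B₁ᴴ, u₁, Matrix.one_mul, u₂]
    rwa [frobSq_mul_of_mul_conjTranspose _ _ w₃, frobSq_mul_of_conjTranspose_mul _ _ hu] at h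
  -- pair (4,1)
  have b₄ : (α₁ * B₁ * B₂ * B₃ * α₄ * B₄).trace.re ≤ (frobSq α₁ + frobSq α₄) / 2 := by
    have h := re_trace_mul_mul_le (α₁ * B₁ * B₂ * B₃) α₄ B₄ w₄
    have h123 : B₁ * B₂ * B₃ * (B₁ * B₂ * B₃)ᴴ = 1 := by
      rw [conjTranspose_mul, conjTranspose_mul, Matrix.mul_assoc, Matrix.mul_assoc,
        ← Matrix.mul_assoc B₃, w₃, Matrix.one_mul, ← Matrix.mul_assoc B₂, w₂, Matrix.one_mul, w₁]
    have e1 : α₁ * B₁ * B₂ * B₃ = α₁ * (B₁ * B₂ * B₃) := by simp only [Matrix.mul_assoc]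
    rw [e1, frobSq_mul_of_mul_conjTranspose _ _ h123] at h
    have e : α₁ * (B₁ * B₂ * B₃) * α₄ * B₄ = α₁ * B₁ * B₂ * B₃ * α₄ * B₄ := by
      simp only [Matrix.mul_assoc]
    rwa [e] at h
  linarith

end SPL

end Summit.Ventures.YMGap.HessianSharp
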